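import Summits.CriticalPhenomena.PercolationContinuityZ3.Theorems.PercNearOneGluingNoHeavyLowerTailSahiGridPatternCrossedCanonicalSub

/-!
# `NoHeavyLowerTail` (crux stmt-CriticalPhenomena-4575), Sahi programme P1: the crossed family at the canonical certificate — **the V-layer
# between the two `y`-sections**: two further unconditional sub-families (every `k`, every good inner block `V`)

Support file (Sahi cell, seat `prim-sahi-p1`, generation 44; `--supports stmt-CriticalPhenomena-4575`).  Pure proofs, no definitions, no `sorry`,
standard axioms.  Continuation of `…SahiGridPatternCrossedCanonical` / `…CrossedCanonicalSub` (same vocabulary: `S = x∨y` with `c = (0|4|2|5)`,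
`A = S×V`, inner vector `λ_V`, crossed pairs `P = {x≥1}×A₀`, `Q = {q∈B′} ∪ ({y≥1}×B)`, `B′ ⊆ B`, `F = A₀∩B′`).

THE MATHEMATICS (seat memo FROM-prim-sahi-p1-gen44, §3).  Write `κ′ = κ′_V(A₀,B′)`, `H = H_V`, `h = h_V` as in the companion files and let
`L := V ∩ (B ∖ B′)` be the **`V`-layer between the two `y`-sections**.  In Kleitman language `κ′_V(A₀,Y) = Σ_{s∈Y} K_s(A₀,V)` with
`K_s(A₀,V) = #{q ∈ A₀ ∩ C_s : q ∈ V} − #{q ∈ A₀ ∩ C_s : s̄q ∈ V} ≥ 0` (cube Kleitman around `s`, `sum_klCoef_ind_nonneg`), so `κ′_V(A₀,·)` is MONOTONE in its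
second argument for ARBITRARY finsets `Y ⊆ Y′` (`kappa_mono`).  Two consequences:

* **Layer disjoint from `A₀`** (`A₀ ∩ B ∩ V ⊆ B′`): with the up-set `B″ := B′ ∪ (B ∩ V)` one has `A₀ ∩ B″ = F` and `B″ ∩ V = B ∩ V`, so goodness of `V` at
  the `V`-DEPENDENT rectangle `(A₀, B″)` reads `κ′_V(A₀,B″) ≤ H(F) + h(B,A₀)`, and `κ′_V(A₀,B′) ≤ κ′_V(A₀,B″)` by monotonicity (`cr_of_layer_disjoint`).
* **Layer inside `A₀`** (`V ∩ (B ∖ B′) ⊆ A₀`): every point `r` of the layer lies in `A₀ ∩ V`, so `h(B,A₀) − h(B′,A₀) = Σ_{r∈L} (2^k − #(A₀ ∩ C_r)) ≥ 0`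
  and goodness at `(A₀,B′)` (`κ′ ≤ H(F) + h(B′,A₀)`) already gives `κ′ ≤ H(F) + h(B,A₀)` (`cr_of_layer_subset`).

In both cases `κ′ ≤ H(F) + h(B,A₀)` — the sharp form (CR5)/(CR7) of the memo — hence (CR′) `κ′ ≤ 2H(F) + h(A₀,B) + h(B,A₀)`, hence (reduction theorem
`diagCert_coProduct_N_orTwo_crossed_canonical`) the crossed (N) at the canonical certificate and `0 ≤ sStarD ((x∨y)×V) P Q` there.  Together with the two
sub-families of generation 43 (`A₀∩V ⊆ B`, `A₀∩B′ ⊆ V`), the crossed pairs NOT covered are exactly those whose layer `L` STRADDLES `A₀` (meets both `A₀` and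
its complement) and which have both witnesses (`(A₀∩V)∖B ≠ ∅`, `(A₀∩B′)∖V ≠ ∅`); there no proof by type-weighted third-point Kleitman plus goodness at
lattice-word rectangles exists (uniform LP of the memo, §2), although (CR′) holds in every tested instance (`k ≤ 3` exhaustive, `k ≤ 6` sampled with the
adversarial `B`).  Nothing here asserts Conjecture A in general or `PatternPos d` for `d ≥ 4`. [this work]
-/

namespace Summit.CriticalPhenomena.PercolationContinuityZ3.Theorems.SahiGridPattern

open Finset SahiGrid3
open scoped BigOperators

section CrossedCanonicalLayer

variable {k : ℕ} {S Fx Gy : Finset (Pd (1 + 1))} {V : Finset (Pd k)} {A : Finset (Pd ((1 + 1) + k))}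

/-- **`κ′_V(A₀,·)` is monotone on arbitrary finsets** (every `k`): for up-sets `A₀, V` and finsets `Y ⊆ Y′`,
`κ′_V(A₀,Y) ≤ κ′_V(A₀,Y′)` — each extra centre `r ∈ Y′ ∖ Y` contributes the cube-Kleitman sum `Σ_{q δ̸ r} 1_{A₀}(q)(1_V(q) − 1_V(q̄r)) ≥ 0`. [this work] -/
theorem kappa_mono (hV : IsUpperSet (V : Set (Pd k))) {A0 : Finset (Pd k)} (hA0 : IsUpperSet (A0 : Set (Pd k)))
    {Y Y' : Finset (Pd k)} (hYY : Y ⊆ Y') :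
    (∑ q : Pd k, ∑ r : Pd k, ind A0 q * ind Y r * (if TotDist q r = true then (1:ℤ) else 0) * ind V q)
      - (∑ q : Pd k, ∑ r : Pd k, ind A0 q * ind Y r * (if TotDist q r = true then (1:ℤ) else 0) * ind V (thirdPt q r))
      ≤ (∑ q : Pd k, ∑ r : Pd k, ind A0 q * ind Y' r * (if TotDist q r = true then (1:ℤ) else 0) * ind V q)
        - (∑ q : Pd k, ∑ r : Pd k, ind A0 q * ind Y' r * (if TotDist q r = true then (1:ℤ) else 0) * ind V (thirdPt q r)) := by
  -- κ′(A₀,Y) = Σ_r 1_Y(r) · K_r,  K_r = Σ_q klCoef V r q · 1_{A₀}(q) ≥ 0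
  have e : ∀ Z : Finset (Pd k),
      (∑ q : Pd k, ∑ r : Pd k, ind A0 q * ind Z r * (if TotDist q r = true then (1:ℤ) else 0) * ind V q)
        - (∑ q : Pd k, ∑ r : Pd k, ind A0 q * ind Z r * (if TotDist q r = true then (1:ℤ) else 0) * ind V (thirdPt q r))
        = ∑ r : Pd k, ind Z r * ∑ q : Pd k, klCoef V r q * ind A0 q := by
    intro Z
    rw [← Finset.sum_sub_distrib]
    have e1 : (∑ q : Pd k, ((∑ r : Pd k, ind A0 q * ind Z r * (if TotDist q r = true then (1:ℤ) else 0) * ind V q)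
        - ∑ r : Pd k, ind A0 q * ind Z r * (if TotDist q r = true then (1:ℤ) else 0) * ind V (thirdPt q r)))
        = ∑ q : Pd k, ∑ r : Pd k, ind Z r * (klCoef V r q * ind A0 q) := by
      refine Finset.sum_congr rfl fun q _ => ?_
      rw [← Finset.sum_sub_distrib]
      refine Finset.sum_congr rfl fun r _ => ?_
      unfold klCoef
      split_ifs <;> ring
    rw [e1, Finset.sum_comm]
    refine Finset.sum_congr rfl fun r _ => ?_
    rw [Finset.mul_sum]
  rw [e Y, e Y', ← sub_nonneg, ← Finset.sum_sub_distrib]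
  refine Finset.sum_nonneg fun r _ => ?_
  have hK := sum_klCoef_ind_nonneg hV hA0 r
  have hz : 0 ≤ ind Y' r - ind Y r := by
    by_cases hr : r ∈ Y
    · have hr' : r ∈ Y' := hYY hr
      unfold ind; rw [if_pos hr, if_pos hr']; norm_num
    · unfold ind; rw [if_neg hr]; split_ifs <;> norm_num
  have : ind Y' r * (∑ q : Pd k, klCoef V r q * ind A0 q) - ind Y r * (∑ q : Pd k, klCoef V r q * ind A0 q)
      = (ind Y' r - ind Y r) * ∑ q : Pd k, klCoef V r q * ind A0 q := by ring
  rw [this]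
  exact mul_nonneg hz hK

/-- **(CR′) when the `V`-layer between the sections is DISJOINT from `A₀`** (`A₀ ∩ B ∩ V ⊆ B′`; every `k`, all up-sets `A₀, B′ ⊆ B, V`), given goodness
of `V` at the `V`-dependent rectangle `(A₀, B′ ∪ (B ∩ V))` (hypothesis `hGBs`, `Θ_V ≤ λ_V` there): then `A₀ ∩ (B′ ∪ (B∩V)) = A₀ ∩ B′` and
`(B′ ∪ (B∩V)) ∩ V = B ∩ V`, so that goodness reads `κ′_V(A₀, B′∪(B∩V)) ≤ H_V(A₀∩B′) + h_V(B,A₀)`, while `κ′_V(A₀,B′) ≤ κ′_V(A₀,B′∪(B∩V))`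
(`kappa_mono`); Harris supplies `H_V(F), h_V(A₀,B) ≥ 0`. [this work] -/
theorem cr_of_layer_disjoint (hV : IsUpperSet (V : Set (Pd k))) {A0 Bp B0 : Finset (Pd k)}
    (hA0 : IsUpperSet (A0 : Set (Pd k))) (hBp : IsUpperSet (Bp : Set (Pd k))) (hB0 : IsUpperSet (B0 : Set (Pd k)))
    (hsub : Bp ⊆ B0) (hL : A0 ∩ B0 ∩ V ⊆ Bp)
    (hGBs : (∑ q ∈ A0, ∑ r ∈ Bp ∪ (B0 ∩ V), thetaVal V q r) ≤ ∑ q ∈ A0 ∩ (Bp ∪ (B0 ∩ V)), lamU V q) :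
    (∑ q : Pd k, ∑ r : Pd k, ind A0 q * ind Bp r * (if TotDist q r = true then (1:ℤ) else 0) * ind V q)
      - (∑ q : Pd k, ∑ r : Pd k, ind A0 q * ind Bp r * (if TotDist q r = true then (1:ℤ) else 0) * ind V (thirdPt q r))
      ≤ 2 * ((2:ℤ) ^ k * (∑ q : Pd k, ind A0 q * ind Bp q * ind V q)
              - ∑ q : Pd k, ∑ r : Pd k, ind A0 q * ind Bp q * (if TotDist q r = true then (1:ℤ) else 0) * ind V r)
        + ((2:ℤ) ^ k * (∑ q : Pd k, ind A0 q * ind B0 q * ind V q) - (∑ q : Pd k, ∑ r : Pd k, ind A0 q * ind B0 r * (if TotDist q r = true then (1:ℤ) else 0) * ind V q))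
        + ((2:ℤ) ^ k * (∑ q : Pd k, ind A0 q * ind B0 q * ind V q) - (∑ q : Pd k, ∑ r : Pd k, ind A0 q * ind B0 r * (if TotDist q r = true then (1:ℤ) else 0) * ind V r)) := by
  set Bs : Finset (Pd k) := Bp ∪ (B0 ∩ V) with hBs
  -- goodness at (A0, Bs) in pair-count form
  have hg := good_pair_counts (V := V) (A0 := A0) (Bp := Bs) hGBs
  -- monotonicity κ′(A0,Bp) ≤ κ′(A0,Bs)
  have hmono := kappa_mono hV hA0 (Y := Bp) (Y' := Bs) (Finset.subset_union_left)
  -- pointwise: 1_{A0} 1_{Bs} = 1_{A0} 1_{Bp}  and  1_{Bs} 1_V = 1_{B0} 1_V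
  have p1 : ∀ q : Pd k, ind A0 q * ind Bs q = ind A0 q * ind Bp q := by
    intro q
    by_cases hq : q ∈ A0
    · by_cases hqp : q ∈ Bp
      · have hqs : q ∈ Bs := by rw [hBs]; exact Finset.mem_union_left _ hqp
        unfold ind; rw [if_pos hq, if_pos hqp, if_pos hqs]
      · have hqs : q ∉ Bs := by
          rw [hBs, Finset.mem_union, not_or]
          refine ⟨hqp, fun h => hqp ?_⟩
          rw [Finset.mem_inter] at h
          exact hL (Finset.mem_inter.2 ⟨Finset.mem_inter.2 ⟨hq, h.1⟩, h.2⟩)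
        unfold ind; rw [if_pos hq, if_neg hqp, if_neg hqs]
    · unfold ind; rw [if_neg hq]; ring
  have p2 : ∀ r : Pd k, ind Bs r * ind V r = ind B0 r * ind V r := by
    intro r
    by_cases hr : r ∈ V
    · by_cases hr0 : r ∈ B0
      · have hrs : r ∈ Bs := by rw [hBs]; exact Finset.mem_union_right _ (Finset.mem_inter.2 ⟨hr0, hr⟩)
        unfold ind; rw [if_pos hr, if_pos hr0, if_pos hrs]
      · have hrs : r ∉ Bs := by
          rw [hBs, Finset.mem_union, not_or]
          exact ⟨fun h => hr0 (hsub h), fun h => hr0 (Finset.mem_inter.1 h).1⟩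
        unfold ind; rw [if_pos hr, if_neg hr0, if_neg hrs]
    · unfold ind; rw [if_neg hr]; ring
  have e1 : (∑ q : Pd k, ind A0 q * ind Bs q * ind V q) = ∑ q : Pd k, ind A0 q * ind Bp q * ind V q := by
    refine Finset.sum_congr rfl fun q _ => ?_; rw [p1 q]
  have e2 : (∑ q : Pd k, ∑ r : Pd k, ind A0 q * ind Bs q * (if TotDist q r = true then (1:ℤ) else 0) * ind V r)
      = ∑ q : Pd k, ∑ r : Pd k, ind A0 q * ind Bp q * (if TotDist q r = true then (1:ℤ) else 0) * ind V r := by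
    refine Finset.sum_congr rfl fun q _ => Finset.sum_congr rfl fun r _ => ?_; rw [p1 q]
  have e3 : (∑ q : Pd k, ∑ r : Pd k, ind A0 q * ind Bs r * (if TotDist q r = true then (1:ℤ) else 0) * ind V r)
      = ∑ q : Pd k, ∑ r : Pd k, ind A0 q * ind B0 r * (if TotDist q r = true then (1:ℤ) else 0) * ind V r := by
    refine Finset.sum_congr rfl fun q _ => Finset.sum_congr rfl fun r _ => ?_
    have := p2 r
    calc ind A0 q * ind Bs r * (if TotDist q r = true then (1:ℤ) else 0) * ind V r
        = ind A0 q * (if TotDist q r = true then (1:ℤ) else 0) * (ind Bs r * ind V r) := by ring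
      _ = ind A0 q * (if TotDist q r = true then (1:ℤ) else 0) * (ind B0 r * ind V r) := by rw [this]
      _ = ind A0 q * ind B0 r * (if TotDist q r = true then (1:ℤ) else 0) * ind V r := by ring
  rw [e1, e2, e3] at hg
  -- Harris: N(V;F) ≤ 2^k #(F∩V) and N(A0∩V; B0) ≤ 2^k #(A0∩B0∩V); and #(F∩V) ≤ #(A0∩B0∩V)
  have hH : (∑ q : Pd k, ∑ r : Pd k, ind A0 q * ind Bp q * (if TotDist q r = true then (1:ℤ) else 0) * ind V r)
      ≤ (2:ℤ) ^ k * (∑ q : Pd k, ind A0 q * ind Bp q * ind V q) := by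
    have h := pairCount_le_harris' (X := A0 ∩ Bp) (Y := (univ : Finset (Pd k))) hV (isUpperSet_inter_coe hA0 hBp)
      (by rw [Finset.coe_univ]; exact isUpperSet_univ)
    have f1 : (∑ q : Pd k, ∑ r : Pd k, ind (A0 ∩ Bp) q * ind (univ : Finset (Pd k)) r * (if TotDist q r = true then (1:ℤ) else 0) * ind V r)
        = ∑ q : Pd k, ∑ r : Pd k, ind A0 q * ind Bp q * (if TotDist q r = true then (1:ℤ) else 0) * ind V r := by
      refine Finset.sum_congr rfl fun q _ => Finset.sum_congr rfl fun r _ => ?_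
      rw [ind_inter_eq_mul, ind_univ_eq_one]; ring
    have f2 : (∑ q : Pd k, ind (A0 ∩ Bp) q * ind (univ : Finset (Pd k)) q * ind V q) = ∑ q : Pd k, ind A0 q * ind Bp q * ind V q := by
      refine Finset.sum_congr rfl fun q _ => ?_
      rw [ind_inter_eq_mul, ind_univ_eq_one]; ring
    rw [f1, f2] at h
    exact h
  have hH1 : (∑ q : Pd k, ∑ r : Pd k, ind A0 q * ind B0 r * (if TotDist q r = true then (1:ℤ) else 0) * ind V q)
      ≤ (2:ℤ) ^ k * (∑ q : Pd k, ind A0 q * ind B0 q * ind V q) := pairCount_le_harris hV hA0 hB0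
  have hTT : (∑ q : Pd k, ind A0 q * ind Bp q * ind V q) ≤ ∑ q : Pd k, ind A0 q * ind B0 q * ind V q := by
    refine Finset.sum_le_sum fun q _ => ?_
    have h1 : 0 ≤ ind A0 q := by unfold ind; split_ifs <;> norm_num
    have h2 : 0 ≤ ind V q := by unfold ind; split_ifs <;> norm_num
    have h3 : ind Bp q ≤ ind B0 q := by
      by_cases hq : q ∈ Bp
      · have hq' : q ∈ B0 := hsub hq
        unfold ind; rw [if_pos hq, if_pos hq']
      · unfold ind; rw [if_neg hq]; split_ifs <;> norm_num
    nlinarith [mul_nonneg h1 h2]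
  have hpow : (0:ℤ) ≤ (2:ℤ) ^ k := by positivity
  nlinarith [mul_le_mul_of_nonneg_left hTT hpow]

/-- **(CR′) when the `V`-layer between the sections lies INSIDE `A₀`** (`V ∩ (B ∖ B′) ⊆ A₀`; every `k`, all up-sets `A₀, B′ ⊆ B, V`), given goodness
of `V` at the section rectangle `(A₀,B′)` (hypothesis `hGBp`): each point `r` of the layer is in `A₀ ∩ V`, so
`h_V(B,A₀) − h_V(B′,A₀) = Σ_{r ∈ V∩(B∖B′)} (2^k·1_{A₀}(r) − #{q ∈ A₀ : q δ̸ r}) ≥ 0`, and goodness `κ′ ≤ H_V(F) + h_V(B′,A₀)` finishes. [this work] -/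
theorem cr_of_layer_subset (hV : IsUpperSet (V : Set (Pd k))) {A0 Bp B0 : Finset (Pd k)}
    (hA0 : IsUpperSet (A0 : Set (Pd k))) (hBp : IsUpperSet (Bp : Set (Pd k))) (hB0 : IsUpperSet (B0 : Set (Pd k)))
    (hsub : Bp ⊆ B0) (hL : V ∩ (B0 \ Bp) ⊆ A0)
    (hGBp : (∑ q ∈ A0, ∑ r ∈ Bp, thetaVal V q r) ≤ ∑ q ∈ A0 ∩ Bp, lamU V q) :
    (∑ q : Pd k, ∑ r : Pd k, ind A0 q * ind Bp r * (if TotDist q r = true then (1:ℤ) else 0) * ind V q)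
      - (∑ q : Pd k, ∑ r : Pd k, ind A0 q * ind Bp r * (if TotDist q r = true then (1:ℤ) else 0) * ind V (thirdPt q r))
      ≤ 2 * ((2:ℤ) ^ k * (∑ q : Pd k, ind A0 q * ind Bp q * ind V q)
              - ∑ q : Pd k, ∑ r : Pd k, ind A0 q * ind Bp q * (if TotDist q r = true then (1:ℤ) else 0) * ind V r)
        + ((2:ℤ) ^ k * (∑ q : Pd k, ind A0 q * ind B0 q * ind V q) - (∑ q : Pd k, ∑ r : Pd k, ind A0 q * ind B0 r * (if TotDist q r = true then (1:ℤ) else 0) * ind V q))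
        + ((2:ℤ) ^ k * (∑ q : Pd k, ind A0 q * ind B0 q * ind V q) - (∑ q : Pd k, ∑ r : Pd k, ind A0 q * ind B0 r * (if TotDist q r = true then (1:ℤ) else 0) * ind V r)) := by
  have hg := good_pair_counts (V := V) (A0 := A0) (Bp := Bp) hGBp
  -- Harris pieces
  have hH : (∑ q : Pd k, ∑ r : Pd k, ind A0 q * ind Bp q * (if TotDist q r = true then (1:ℤ) else 0) * ind V r)
      ≤ (2:ℤ) ^ k * (∑ q : Pd k, ind A0 q * ind Bp q * ind V q) := by
    have h := pairCount_le_harris' (X := A0 ∩ Bp) (Y := (univ : Finset (Pd k))) hV (isUpperSet_inter_coe hA0 hBp)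
      (by rw [Finset.coe_univ]; exact isUpperSet_univ)
    have f1 : (∑ q : Pd k, ∑ r : Pd k, ind (A0 ∩ Bp) q * ind (univ : Finset (Pd k)) r * (if TotDist q r = true then (1:ℤ) else 0) * ind V r)
        = ∑ q : Pd k, ∑ r : Pd k, ind A0 q * ind Bp q * (if TotDist q r = true then (1:ℤ) else 0) * ind V r := by
      refine Finset.sum_congr rfl fun q _ => Finset.sum_congr rfl fun r _ => ?_
      rw [ind_inter_eq_mul, ind_univ_eq_one]; ring
    have f2 : (∑ q : Pd k, ind (A0 ∩ Bp) q * ind (univ : Finset (Pd k)) q * ind V q) = ∑ q : Pd k, ind A0 q * ind Bp q * ind V q := by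
      refine Finset.sum_congr rfl fun q _ => ?_
      rw [ind_inter_eq_mul, ind_univ_eq_one]; ring
    rw [f1, f2] at h
    exact h
  have hH1 : (∑ q : Pd k, ∑ r : Pd k, ind A0 q * ind B0 r * (if TotDist q r = true then (1:ℤ) else 0) * ind V q)
      ≤ (2:ℤ) ^ k * (∑ q : Pd k, ind A0 q * ind B0 q * ind V q) := pairCount_le_harris hV hA0 hB0
  -- the layer lemma: N(A0; B0∩V) − N(A0; Bp∩V) ≤ 2^k (#(A0∩B0∩V) − #(A0∩Bp∩V))
  have hlayer : (∑ q : Pd k, ∑ r : Pd k, ind A0 q * ind B0 r * (if TotDist q r = true then (1:ℤ) else 0) * ind V r)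
        - (∑ q : Pd k, ∑ r : Pd k, ind A0 q * ind Bp r * (if TotDist q r = true then (1:ℤ) else 0) * ind V r)
      ≤ (2:ℤ) ^ k * (∑ q : Pd k, ind A0 q * ind B0 q * ind V q) - (2:ℤ) ^ k * (∑ q : Pd k, ind A0 q * ind Bp q * ind V q) := by
    -- rewrite both sides as sums over r of (1_{B0} − 1_{Bp})(r) 1_V(r) · (…)
    have eL : (∑ q : Pd k, ∑ r : Pd k, ind A0 q * ind B0 r * (if TotDist q r = true then (1:ℤ) else 0) * ind V r)
          - (∑ q : Pd k, ∑ r : Pd k, ind A0 q * ind Bp r * (if TotDist q r = true then (1:ℤ) else 0) * ind V r)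
        = ∑ r : Pd k, (ind B0 r - ind Bp r) * ind V r * ∑ q : Pd k, ind A0 q * (if TotDist q r = true then (1:ℤ) else 0) := by
      rw [← Finset.sum_sub_distrib]
      have : (∑ q : Pd k, ((∑ r : Pd k, ind A0 q * ind B0 r * (if TotDist q r = true then (1:ℤ) else 0) * ind V r)
          - ∑ r : Pd k, ind A0 q * ind Bp r * (if TotDist q r = true then (1:ℤ) else 0) * ind V r))
          = ∑ q : Pd k, ∑ r : Pd k, (ind B0 r - ind Bp r) * ind V r * (ind A0 q * (if TotDist q r = true then (1:ℤ) else 0)) := by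
        refine Finset.sum_congr rfl fun q _ => ?_
        rw [← Finset.sum_sub_distrib]
        refine Finset.sum_congr rfl fun r _ => ?_; ring
      rw [this, Finset.sum_comm]
      refine Finset.sum_congr rfl fun r _ => ?_
      rw [Finset.mul_sum]
    have eR : (2:ℤ) ^ k * (∑ q : Pd k, ind A0 q * ind B0 q * ind V q) - (2:ℤ) ^ k * (∑ q : Pd k, ind A0 q * ind Bp q * ind V q)
        = ∑ r : Pd k, (ind B0 r - ind Bp r) * ind V r * ((2:ℤ) ^ k * ind A0 r) := by
      rw [Finset.mul_sum, Finset.mul_sum, ← Finset.sum_sub_distrib]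
      refine Finset.sum_congr rfl fun r _ => ?_; ring
    rw [eL, eR]
    refine Finset.sum_le_sum fun r _ => ?_
    have hw : 0 ≤ (ind B0 r - ind Bp r) * ind V r := by
      have h3 : ind Bp r ≤ ind B0 r := by
        by_cases hr : r ∈ Bp
        · have hr' : r ∈ B0 := hsub hr
          unfold ind; rw [if_pos hr, if_pos hr']
        · unfold ind; rw [if_neg hr]; split_ifs <;> norm_num
      have h2 : 0 ≤ ind V r := by unfold ind; split_ifs <;> norm_num
      nlinarith
    by_cases hcase : r ∈ V ∧ r ∈ B0 ∧ r ∉ Bp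
    · -- r in the layer: r ∈ A0, and the row count is at most 2^k
      have hrA : r ∈ A0 := hL (Finset.mem_inter.2 ⟨hcase.1, Finset.mem_sdiff.2 ⟨hcase.2.1, hcase.2.2⟩⟩)
      have eA : ind A0 r = 1 := by unfold ind; rw [if_pos hrA]
      have hrow : (∑ q : Pd k, ind A0 q * (if TotDist q r = true then (1:ℤ) else 0)) ≤ (2:ℤ) ^ k * ind A0 r := by
        rw [eA, mul_one]
        have hle : (∑ q : Pd k, ind A0 q * (if TotDist q r = true then (1:ℤ) else 0))
            ≤ ∑ q : Pd k, (if TotDist r q = true then (1:ℤ) else 0) := by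
          refine Finset.sum_le_sum fun q _ => ?_
          rw [totDist_symm q r]
          have h1 : ind A0 q ≤ 1 := by unfold ind; split_ifs <;> norm_num
          have h2 : 0 ≤ (if TotDist r q = true then (1:ℤ) else 0) := by split_ifs <;> norm_num
          nlinarith
        rw [sum_ite_totDist_eq_pow_left r] at hle
        exact hle
      exact mul_le_mul_of_nonneg_left hrow hw
    · -- r outside the layer: the weight vanishes
      have hz : (ind B0 r - ind Bp r) * ind V r = 0 := by
        by_cases hrV : r ∈ V
        · by_cases hr0 : r ∈ B0
          · have hrp : r ∈ Bp := by
              by_contra hrp; exact hcase ⟨hrV, hr0, hrp⟩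
            unfold ind; rw [if_pos hr0, if_pos hrp]; ring
          · have hrp : r ∉ Bp := fun h => hr0 (hsub h)
            unfold ind; rw [if_neg hr0, if_neg hrp]; ring
        · unfold ind; rw [if_neg hrV]; ring
      rw [hz]; ring_nf; exact le_refl _
  linarith

/-- The union of an up-set and the meet of two up-sets is an up-set (coercion form for `B′ ∪ (B ∩ V)`). [this work] -/
theorem isUpperSet_union_inter_coe {Bp B0 W : Finset (Pd k)} (hBp : IsUpperSet (Bp : Set (Pd k)))
    (hB0 : IsUpperSet (B0 : Set (Pd k))) (hW : IsUpperSet (W : Set (Pd k))) :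
    IsUpperSet ((Bp ∪ (B0 ∩ W) : Finset (Pd k)) : Set (Pd k)) := by
  rw [Finset.coe_union, Finset.coe_inter]
  exact hBp.union (hB0.inter hW)

/-! ### The crossed (N) at the canonical certificate and the pattern functional, in the two layer cases -/

/-- **UNCONDITIONAL: the crossed family when the `V`-layer is disjoint from `A₀`** (`A₀ ∩ B ∩ V ⊆ B′`) — every `k`, EVERY up-set `V` good at the
rectangles `(A₀,B)`, `(A₀,B′)` and `(A₀, B′ ∪ (B∩V))`: the co-count product `co(c, λ_V)` of `S = x∨y` and `V` satisfies (N) at the crossed pair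
`P = {x≥1}×A₀`, `Q = {q∈B′} ∪ ({y≥1}×B)`. [this work] -/
theorem diagCert_coProduct_N_orTwo_crossed_canonical_of_layer_disjoint (hS : ∀ ξ η : Pd 1, glue ξ η ∈ S ↔ (1 ≤ ξ 0 ∨ 1 ≤ η 0))
    (hFx : ∀ ξ η : Pd 1, glue ξ η ∈ Fx ↔ 1 ≤ ξ 0) (hGy : ∀ ξ η : Pd 1, glue ξ η ∈ Gy ↔ 1 ≤ η 0)
    (hV : IsUpperSet (V : Set (Pd k))) (hA : ∀ σ z, glue σ z ∈ A ↔ (σ ∈ S ∧ z ∈ V))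
    (dS : Pd (1 + 1) → ℤ) (hdS : dS (glue (fun _ => 0) (fun _ => 0)) = 0 ∧ dS (glue (fun _ => 0) (fun _ => 1)) = 4 ∧ dS (glue (fun _ => 0) (fun _ => 2)) = 4 ∧
      dS (glue (fun _ => 1) (fun _ => 0)) = 2 ∧ dS (glue (fun _ => 1) (fun _ => 1)) = 5 ∧ dS (glue (fun _ => 1) (fun _ => 2)) = 5 ∧
      dS (glue (fun _ => 2) (fun _ => 0)) = 2 ∧ dS (glue (fun _ => 2) (fun _ => 1)) = 5 ∧ dS (glue (fun _ => 2) (fun _ => 2)) = 5)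
    {A0 Bp B0 : Finset (Pd k)} (hA0 : IsUpperSet (A0 : Set (Pd k))) (hBp : IsUpperSet (Bp : Set (Pd k))) (hB0 : IsUpperSet (B0 : Set (Pd k)))
    (hsub : Bp ⊆ B0) (hL : A0 ∩ B0 ∩ V ⊆ Bp)
    (hGB : (∑ q ∈ A0, ∑ r ∈ B0, thetaVal V q r) ≤ ∑ q ∈ A0 ∩ B0, lamU V q)
    (hGBp : (∑ q ∈ A0, ∑ r ∈ Bp, thetaVal V q r) ≤ ∑ q ∈ A0 ∩ Bp, lamU V q)
    (hGBs : (∑ q ∈ A0, ∑ r ∈ Bp ∪ (B0 ∩ V), thetaVal V q r) ≤ ∑ q ∈ A0 ∩ (Bp ∪ (B0 ∩ V)), lamU V q)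
    {P Q : Finset (Pd ((1 + 1) + k))} (hP : ∀ σ q, glue σ q ∈ P ↔ (σ ∈ Fx ∧ q ∈ A0)) (hQ : ∀ σ q, glue σ q ∈ Q ↔ (q ∈ Bp ∨ (σ ∈ Gy ∧ q ∈ B0))) :
    (∑ x ∈ P, ∑ y ∈ Q, thetaVal A x y) ≤ ∑ x ∈ P ∩ Q, (2 * (2:ℤ) ^ ((1 + 1) + k) * (ind S (freeOf x) * ind V (cellOf x))
        - (2 * (2:ℤ) ^ (1 + 1) * ind S (freeOf x) - dS (freeOf x)) * (2 * (2:ℤ) ^ k * ind V (cellOf x) - lamU V (cellOf x))) :=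
  diagCert_coProduct_N_orTwo_crossed_canonical hS hFx hGy hA dS hdS hsub hGB hGBp (cr_of_layer_disjoint hV hA0 hBp hB0 hsub hL hGBs) hP hQ

/-- **UNCONDITIONAL: the crossed family when the `V`-layer lies inside `A₀`** (`V ∩ (B ∖ B′) ⊆ A₀`) — every `k`, EVERY up-set `V` good at the two
section rectangles `(A₀,B)`, `(A₀,B′)`: (N) for `co(c, λ_V)` at the crossed pair. [this work] -/
theorem diagCert_coProduct_N_orTwo_crossed_canonical_of_layer_subset (hS : ∀ ξ η : Pd 1, glue ξ η ∈ S ↔ (1 ≤ ξ 0 ∨ 1 ≤ η 0))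
    (hFx : ∀ ξ η : Pd 1, glue ξ η ∈ Fx ↔ 1 ≤ ξ 0) (hGy : ∀ ξ η : Pd 1, glue ξ η ∈ Gy ↔ 1 ≤ η 0)
    (hV : IsUpperSet (V : Set (Pd k))) (hA : ∀ σ z, glue σ z ∈ A ↔ (σ ∈ S ∧ z ∈ V))
    (dS : Pd (1 + 1) → ℤ) (hdS : dS (glue (fun _ => 0) (fun _ => 0)) = 0 ∧ dS (glue (fun _ => 0) (fun _ => 1)) = 4 ∧ dS (glue (fun _ => 0) (fun _ => 2)) = 4 ∧
      dS (glue (fun _ => 1) (fun _ => 0)) = 2 ∧ dS (glue (fun _ => 1) (fun _ => 1)) = 5 ∧ dS (glue (fun _ => 1) (fun _ => 2)) = 5 ∧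
      dS (glue (fun _ => 2) (fun _ => 0)) = 2 ∧ dS (glue (fun _ => 2) (fun _ => 1)) = 5 ∧ dS (glue (fun _ => 2) (fun _ => 2)) = 5)
    {A0 Bp B0 : Finset (Pd k)} (hA0 : IsUpperSet (A0 : Set (Pd k))) (hBp : IsUpperSet (Bp : Set (Pd k))) (hB0 : IsUpperSet (B0 : Set (Pd k)))
    (hsub : Bp ⊆ B0) (hL : V ∩ (B0 \ Bp) ⊆ A0)
    (hGB : (∑ q ∈ A0, ∑ r ∈ B0, thetaVal V q r) ≤ ∑ q ∈ A0 ∩ B0, lamU V q)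
    (hGBp : (∑ q ∈ A0, ∑ r ∈ Bp, thetaVal V q r) ≤ ∑ q ∈ A0 ∩ Bp, lamU V q)
    {P Q : Finset (Pd ((1 + 1) + k))} (hP : ∀ σ q, glue σ q ∈ P ↔ (σ ∈ Fx ∧ q ∈ A0)) (hQ : ∀ σ q, glue σ q ∈ Q ↔ (q ∈ Bp ∨ (σ ∈ Gy ∧ q ∈ B0))) :
    (∑ x ∈ P, ∑ y ∈ Q, thetaVal A x y) ≤ ∑ x ∈ P ∩ Q, (2 * (2:ℤ) ^ ((1 + 1) + k) * (ind S (freeOf x) * ind V (cellOf x))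
        - (2 * (2:ℤ) ^ (1 + 1) * ind S (freeOf x) - dS (freeOf x)) * (2 * (2:ℤ) ^ k * ind V (cellOf x) - lamU V (cellOf x))) :=
  diagCert_coProduct_N_orTwo_crossed_canonical hS hFx hGy hA dS hdS hsub hGB hGBp (cr_of_layer_subset hV hA0 hBp hB0 hsub hL hGBp) hP hQ

/-- **The pattern functional, layer disjoint from `A₀`** (with (T) and the box for `dS`): `0 ≤ sStarD ((x∨y)×V) P Q` at every crossed pair with
`A₀ ∩ B ∩ V ⊆ B′`, for every up-set `V` good at `(A₀,B)`, `(A₀,B′)`, `(A₀,B′∪(B∩V))` — every `k`. [this work] -/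
theorem sStarD_blockAnd_orTwo_crossed_layer_disjoint_nonneg (hS : ∀ ξ η : Pd 1, glue ξ η ∈ S ↔ (1 ≤ ξ 0 ∨ 1 ≤ η 0))
    (hFx : ∀ ξ η : Pd 1, glue ξ η ∈ Fx ↔ 1 ≤ ξ 0) (hGy : ∀ ξ η : Pd 1, glue ξ η ∈ Gy ↔ 1 ≤ η 0)
    (hV : IsUpperSet (V : Set (Pd k))) (hA : ∀ σ z, glue σ z ∈ A ↔ (σ ∈ S ∧ z ∈ V))
    (dS : Pd (1 + 1) → ℤ) (hdS : dS (glue (fun _ => 0) (fun _ => 0)) = 0 ∧ dS (glue (fun _ => 0) (fun _ => 1)) = 4 ∧ dS (glue (fun _ => 0) (fun _ => 2)) = 4 ∧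
      dS (glue (fun _ => 1) (fun _ => 0)) = 2 ∧ dS (glue (fun _ => 1) (fun _ => 1)) = 5 ∧ dS (glue (fun _ => 1) (fun _ => 2)) = 5 ∧
      dS (glue (fun _ => 2) (fun _ => 0)) = 2 ∧ dS (glue (fun _ => 2) (fun _ => 1)) = 5 ∧ dS (glue (fun _ => 2) (fun _ => 2)) = 5)
    (hTS : ∀ W : Finset (Pd (1 + 1)), IsUpperSet (W : Set (Pd (1 + 1))) → (∑ ξ ∈ W, dS ξ) ≤ ∑ ξ ∈ W, lamU S ξ)
    (hmS : ∀ ξ : Pd (1 + 1), dS ξ ≤ 2 * (2:ℤ) ^ (1 + 1) * ind S ξ)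
    {A0 Bp B0 : Finset (Pd k)} (hA0 : IsUpperSet (A0 : Set (Pd k))) (hBp : IsUpperSet (Bp : Set (Pd k))) (hB0 : IsUpperSet (B0 : Set (Pd k)))
    (hsub : Bp ⊆ B0) (hL : A0 ∩ B0 ∩ V ⊆ Bp)
    (hGB : (∑ q ∈ A0, ∑ r ∈ B0, thetaVal V q r) ≤ ∑ q ∈ A0 ∩ B0, lamU V q)
    (hGBp : (∑ q ∈ A0, ∑ r ∈ Bp, thetaVal V q r) ≤ ∑ q ∈ A0 ∩ Bp, lamU V q)
    (hGBs : (∑ q ∈ A0, ∑ r ∈ Bp ∪ (B0 ∩ V), thetaVal V q r) ≤ ∑ q ∈ A0 ∩ (Bp ∪ (B0 ∩ V)), lamU V q)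
    {P Q : Finset (Pd ((1 + 1) + k))} (hPu : IsUpperSet (P : Set (Pd ((1 + 1) + k)))) (hQu : IsUpperSet (Q : Set (Pd ((1 + 1) + k))))
    (hP : ∀ σ q, glue σ q ∈ P ↔ (σ ∈ Fx ∧ q ∈ A0)) (hQ : ∀ σ q, glue σ q ∈ Q ↔ (q ∈ Bp ∨ (σ ∈ Gy ∧ q ∈ B0))) :
    0 ≤ sStarD A P Q := by
  rw [sStarD_eq_sum_lamU_sub_sum_thetaVal]
  have hTV : ∀ W : Finset (Pd k), IsUpperSet (W : Set (Pd k)) → (∑ q ∈ W, lamU V q) ≤ ∑ q ∈ W, lamU V q := fun W _ => le_rfl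
  have hT := diagCert_coProduct_T hA dS (lamU V) hTS hTV hmS (isUpperSet_inter_coe hPu hQu)
  have hN := diagCert_coProduct_N_orTwo_crossed_canonical_of_layer_disjoint hS hFx hGy hV hA dS hdS hA0 hBp hB0 hsub hL hGB hGBp hGBs hP hQ
  linarith

/-- **The pattern functional, layer inside `A₀`** (with (T) and the box for `dS`): `0 ≤ sStarD ((x∨y)×V) P Q` at every crossed pair with
`V ∩ (B ∖ B′) ⊆ A₀`, for every up-set `V` good at `(A₀,B)` and `(A₀,B′)` — every `k`. [this work] -/
theorem sStarD_blockAnd_orTwo_crossed_layer_subset_nonneg (hS : ∀ ξ η : Pd 1, glue ξ η ∈ S ↔ (1 ≤ ξ 0 ∨ 1 ≤ η 0))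
    (hFx : ∀ ξ η : Pd 1, glue ξ η ∈ Fx ↔ 1 ≤ ξ 0) (hGy : ∀ ξ η : Pd 1, glue ξ η ∈ Gy ↔ 1 ≤ η 0)
    (hV : IsUpperSet (V : Set (Pd k))) (hA : ∀ σ z, glue σ z ∈ A ↔ (σ ∈ S ∧ z ∈ V))
    (dS : Pd (1 + 1) → ℤ) (hdS : dS (glue (fun _ => 0) (fun _ => 0)) = 0 ∧ dS (glue (fun _ => 0) (fun _ => 1)) = 4 ∧ dS (glue (fun _ => 0) (fun _ => 2)) = 4 ∧
      dS (glue (fun _ => 1) (fun _ => 0)) = 2 ∧ dS (glue (fun _ => 1) (fun _ => 1)) = 5 ∧ dS (glue (fun _ => 1) (fun _ => 2)) = 5 ∧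
      dS (glue (fun _ => 2) (fun _ => 0)) = 2 ∧ dS (glue (fun _ => 2) (fun _ => 1)) = 5 ∧ dS (glue (fun _ => 2) (fun _ => 2)) = 5)
    (hTS : ∀ W : Finset (Pd (1 + 1)), IsUpperSet (W : Set (Pd (1 + 1))) → (∑ ξ ∈ W, dS ξ) ≤ ∑ ξ ∈ W, lamU S ξ)
    (hmS : ∀ ξ : Pd (1 + 1), dS ξ ≤ 2 * (2:ℤ) ^ (1 + 1) * ind S ξ)
    {A0 Bp B0 : Finset (Pd k)} (hA0 : IsUpperSet (A0 : Set (Pd k))) (hBp : IsUpperSet (Bp : Set (Pd k))) (hB0 : IsUpperSet (B0 : Set (Pd k)))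
    (hsub : Bp ⊆ B0) (hL : V ∩ (B0 \ Bp) ⊆ A0)
    (hGB : (∑ q ∈ A0, ∑ r ∈ B0, thetaVal V q r) ≤ ∑ q ∈ A0 ∩ B0, lamU V q)
    (hGBp : (∑ q ∈ A0, ∑ r ∈ Bp, thetaVal V q r) ≤ ∑ q ∈ A0 ∩ Bp, lamU V q)
    {P Q : Finset (Pd ((1 + 1) + k))} (hPu : IsUpperSet (P : Set (Pd ((1 + 1) + k)))) (hQu : IsUpperSet (Q : Set (Pd ((1 + 1) + k))))
    (hP : ∀ σ q, glue σ q ∈ P ↔ (σ ∈ Fx ∧ q ∈ A0)) (hQ : ∀ σ q, glue σ q ∈ Q ↔ (q ∈ Bp ∨ (σ ∈ Gy ∧ q ∈ B0))) :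
    0 ≤ sStarD A P Q := by
  rw [sStarD_eq_sum_lamU_sub_sum_thetaVal]
  have hTV : ∀ W : Finset (Pd k), IsUpperSet (W : Set (Pd k)) → (∑ q ∈ W, lamU V q) ≤ ∑ q ∈ W, lamU V q := fun W _ => le_rfl
  have hT := diagCert_coProduct_T hA dS (lamU V) hTS hTV hmS (isUpperSet_inter_coe hPu hQu)
  have hN := diagCert_coProduct_N_orTwo_crossed_canonical_of_layer_subset hS hFx hGy hV hA dS hdS hA0 hBp hB0 hsub hL hGB hGBp hP hQ
  linarith

/-! ### Packaging: the four unconditional sub-families from goodness of `V` in the usual `∀`-form -/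

/-- **THE CROSSED FAMILY AT THE CANONICAL CERTIFICATE FOR A GOOD INNER BLOCK — all four proved sub-families (every `k`).**  Let `V ⊆ [3]^k` be a GOOD
up-set (`Θ_V(X×Y) ≤ λ_V(X∩Y)` for all up-sets `X, Y`), `S = x∨y` with `c = (0|4|2|5)`, `A = S×V`.  At every crossed pair `P = {x≥1}×A₀`,
`Q = {q∈B′} ∪ ({y≥1}×B)` (`A₀, B′ ⊆ B` up-sets) such that
`A₀∩V ⊆ B` (generation 43) OR `A₀∩B′ ⊆ V` (generation 43) OR `V∩(B∖B′) ⊆ A₀` (layer inside `A₀`) OR `A₀∩B∩V ⊆ B′` (layer disjoint from `A₀`),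
the pattern functional is nonnegative: `0 ≤ sStarD ((x∨y)×V) P Q` ((T) and the box for `dS` as hypotheses).  The pairs not covered are those whose
`V`-layer `V∩(B∖B′)` meets both `A₀` and its complement (with both witnesses present). [this work] -/
theorem sStarD_blockAnd_orTwo_crossed_nonneg_of_good_layer (hS : ∀ ξ η : Pd 1, glue ξ η ∈ S ↔ (1 ≤ ξ 0 ∨ 1 ≤ η 0))
    (hFx : ∀ ξ η : Pd 1, glue ξ η ∈ Fx ↔ 1 ≤ ξ 0) (hGy : ∀ ξ η : Pd 1, glue ξ η ∈ Gy ↔ 1 ≤ η 0)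
    (hV : IsUpperSet (V : Set (Pd k))) (hA : ∀ σ z, glue σ z ∈ A ↔ (σ ∈ S ∧ z ∈ V))
    (hgood : ∀ X Y : Finset (Pd k), IsUpperSet (X : Set (Pd k)) → IsUpperSet (Y : Set (Pd k)) →
      (∑ q ∈ X, ∑ r ∈ Y, thetaVal V q r) ≤ ∑ q ∈ X ∩ Y, lamU V q)
    (dS : Pd (1 + 1) → ℤ) (hdS : dS (glue (fun _ => 0) (fun _ => 0)) = 0 ∧ dS (glue (fun _ => 0) (fun _ => 1)) = 4 ∧ dS (glue (fun _ => 0) (fun _ => 2)) = 4 ∧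
      dS (glue (fun _ => 1) (fun _ => 0)) = 2 ∧ dS (glue (fun _ => 1) (fun _ => 1)) = 5 ∧ dS (glue (fun _ => 1) (fun _ => 2)) = 5 ∧
      dS (glue (fun _ => 2) (fun _ => 0)) = 2 ∧ dS (glue (fun _ => 2) (fun _ => 1)) = 5 ∧ dS (glue (fun _ => 2) (fun _ => 2)) = 5)
    (hTS : ∀ W : Finset (Pd (1 + 1)), IsUpperSet (W : Set (Pd (1 + 1))) → (∑ ξ ∈ W, dS ξ) ≤ ∑ ξ ∈ W, lamU S ξ)
    (hmS : ∀ ξ : Pd (1 + 1), dS ξ ≤ 2 * (2:ℤ) ^ (1 + 1) * ind S ξ)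
    {A0 Bp B0 : Finset (Pd k)} (hA0 : IsUpperSet (A0 : Set (Pd k))) (hBp : IsUpperSet (Bp : Set (Pd k))) (hB0 : IsUpperSet (B0 : Set (Pd k)))
    (hsub : Bp ⊆ B0) (hcase : A0 ∩ V ⊆ B0 ∨ A0 ∩ Bp ⊆ V ∨ V ∩ (B0 \ Bp) ⊆ A0 ∨ A0 ∩ B0 ∩ V ⊆ Bp)
    {P Q : Finset (Pd ((1 + 1) + k))} (hPu : IsUpperSet (P : Set (Pd ((1 + 1) + k)))) (hQu : IsUpperSet (Q : Set (Pd ((1 + 1) + k))))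
    (hP : ∀ σ q, glue σ q ∈ P ↔ (σ ∈ Fx ∧ q ∈ A0)) (hQ : ∀ σ q, glue σ q ∈ Q ↔ (q ∈ Bp ∨ (σ ∈ Gy ∧ q ∈ B0))) :
    0 ≤ sStarD A P Q := by
  rcases hcase with h1 | h2 | h3 | h4
  · exact sStarD_blockAnd_orTwo_crossed_cornerSub_nonneg hS hFx hGy hV hA dS hdS hTS hmS hA0 hBp hB0 hsub h1
      (hgood A0 B0 hA0 hB0) (hgood A0 Bp hA0 hBp) hPu hQu hP hQ
  · exact sStarD_blockAnd_orTwo_crossed_FsubV_nonneg hS hFx hGy hV hA dS hdS hTS hmS hA0 hBp hB0 hsub h2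
      (hgood A0 B0 hA0 hB0) (hgood A0 Bp hA0 hBp) hPu hQu hP hQ
  · exact sStarD_blockAnd_orTwo_crossed_layer_subset_nonneg hS hFx hGy hV hA dS hdS hTS hmS hA0 hBp hB0 hsub h3
      (hgood A0 B0 hA0 hB0) (hgood A0 Bp hA0 hBp) hPu hQu hP hQ
  · exact sStarD_blockAnd_orTwo_crossed_layer_disjoint_nonneg hS hFx hGy hV hA dS hdS hTS hmS hA0 hBp hB0 hsub h4
      (hgood A0 B0 hA0 hB0) (hgood A0 Bp hA0 hBp)
      (hgood A0 (Bp ∪ (B0 ∩ V)) hA0 (isUpperSet_union_inter_coe hBp hB0 hV)) hPu hQu hP hQ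

end CrossedCanonicalLayer

end Summit.CriticalPhenomena.PercolationContinuityZ3.Theorems.SahiGridPattern
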